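import Literature.AnabelianGeometry.EtaleTheta.Discharge.Sec1CuspCyclotomicEquiv
import Literature.AnabelianGeometry.EtaleTheta.Discharge.Sec1NoCentralCuspAtJointOrigin
import Literature.AnabelianGeometry.EtaleTheta.Discharge.Sec1OncePuncturedDataOfOrigin
import HarnessLib

/-!
# [EtTh] §1 / Def. 2.1: the CUSP PROFILE of a joint origin in one place — everything the §1 origin clauses force about
# «the decomposition group of the unique cusp» (one projection away for consumers)

Mochizuki, *The étale theta function …*, Publ. RIMS **45** (2009) [EtTh], §1 p. 13 («any decomposition group of a cusp
of `Y^log` determines … a section `G_K → (Π^tp_Y)^ell` … `Y_N → Y`»), p. 16 («`Δ^tp_Y/Δ^tp_{Y_N} ≅ ℤ/Nℤ(1)`»), Def. 2.1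
p. 35 («`D_x → Π^Θ_X` … maps the inertia group `I_x ⊆ D_x` isomorphically onto `Δ_Θ`», «`1 → Δ_Θ → D̄_x → G_K → 1`»)
[cite: MochizukiEtTh2009, Def 2.1 p.35]; [SemiAnbd] §6 p. 71 («`I_x ≅ Ẑ(1)`») [cite: MochizukiSemiAnbd2006, §6 p.71].
abc-iut cell, layer L2, seat abc-iut-w5-d051 (gen 4; NV / §1-interface lane) — SUMMARY ADAPTER of the lane's files
p449035 (`Sec1CuspInertiaEllDivisible`), p451482 (`Sec1EllPowersSeparated`), p452622 (`Sec1CuspInertiaTateTwist`),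
p455763 (`Sec1NoCentralCuspAtJointOrigin`), p457285 (`Sec1DeltaThetaTateTwistExact`), p458429 (`Sec1CuspRationalOfR2`),
p459204 (`Sec1OncePuncturedDataOfOrigin`), p459610 (`Sec1CuspCyclotomicEquiv`); compare abc-iut-L2-t7's
`CuspLaws.cusp_profile` (which READS the cusp laws; here everything except C3/C9/C16 is DERIVED).

* **`ThetaSetting.jointOrigin_cusp_profile`** — at `IsEtThOrigin` + `hYcl` + `IsThm16Origin` + `IsTateOrigin` + `CuspLaws`
  + `OncePuncturedData`, for every cusp `x`: (1) `D_x ⊆ Π^tp_Y`; (2) `aug(D_x) = G_K` (the cusp is `K`-rational — from R2);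
  (3) `I_x ⊆ Ker(Π^tp_X ↠ (Π^tp_X)^ell)` (from TM + R2); (4) `toTheta(I_x) = Δ_Θ` (C3); (5) `D_x` does NOT centralise `I_x`,
  (6) `D_x` is non-abelian (from TM + R2 + C3); (7) `I_x ≃ₜ* Ẑ` EQUIVARIANTLY for the cyclotomic character `χ ∘ aug`
  («`I_x ≅ Ẑ(1)`», from TM + R2 + C3); (8) `Δ^tp_{Y_N}` is the `N`-th-power locus of `(Δ^tp_Y)^ell` for every `N`.
* `ThetaSetting.jointOrigin_cusp_profile_noCuspLaws` — the part that needs NO cusp law ((1)(2)(3)(8) + compactness).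

PROOF-ONLY: no definition, no instance, no named fact; every conjunct is a landed theorem consumed BY NAME.  HONEST
FRAMING: the hypotheses are the origin predicates / census predicates of the frozen root, inhabited only at models (the
conjunction `IsThm16Origin ∧ IsTateOrigin ∧ CuspLaws` at NO model of the cell: abc-iut-w5-d051 p443517 / p455763,
abc-iut-w5-d165 p447070); nothing of [EtTh]/[SemiAnbd] is asserted for genuine tempered fundamental groups; no side is
taken on [IUTchIII] Cor. 3.12; typed ≠ proved.
-/

noncomputable section

namespace Literature.AnabelianGeometry.EtaleTheta

open Literature.AnabelianGeometry.SemiGraphs Thm16Sub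
open scoped Pointwise

namespace ThetaSetting

variable {p : ℕ} [Fact p.Prime] {D : ThetaSetting p}

/-- **The cusp profile of an origin WITHOUT cusp laws** (`IsThm16Origin` + `IsTateOrigin` + group-level datum): for every
cusp `x`, `D_x ⊆ Π^tp_Y`, `aug(D_x) = G_K`, `D_x` compact, `I_x ⊆ Ker(↠ell)`, `toTheta(I_x) ⊆ Δ_Θ`, and
`Δ^tp_{Y_N} = {y ∈ Δ^tp_Y | y^ell ∈ N·(Δ^tp_Y)^ell}` for every `N`. [cite: MochizukiEtTh2009, §1 p.13] -/
theorem jointOrigin_cusp_profile_noCuspLaws (h16 : D.IsThm16Origin) (hT : D.IsTateOrigin)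
    (d : D.toTemperedCurve.GroupLevelData) {x : D.Pt} (hx : D.IsCusp x) :
    D.decomp x ≤ D.GtpY ∧ (D.decomp x).map D.aug.toMonoidHom = D.GK ∧ IsCompact (D.decomp x : Set D.PiTemp) ∧
      D.inertia x ≤ (toEll D).ker ∧ (D.inertia x).map D.toTheta ≤ D.DeltaTheta ∧
      ∀ N : ℕ+, D.DtpYN N = D.DtpY ⊓ (ellPowersY D N).comap (toEll D) := by
  have hP3 : D.decomp x ≤ D.GtpY := D.decomp_le_GtpY_of_groupLevelData d x
  have hDc : D.IsCuspidalDecompositionGroup (D.decomp x) := ⟨x, hx, 1, (one_smul _ _).symm⟩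
  exact ⟨hP3, h16.map_aug_decomp_eq_GK hx hP3, D.toTemperedCurve.decompCompact_of_groupLevelData d x,
    D.inertia_le_ker_toEll_of_origins h16 hT hDc hP3,
    D.map_toTheta_inertia_le_deltaTheta_of_origins h16 hT hDc hP3,
    fun N => D.dtpYN_eq_of_origins h16 hT N⟩

/-- **THE CUSP PROFILE OF A JOINT ORIGIN** (`IsEtThOrigin` + `hYcl` + `IsThm16Origin` + `IsTateOrigin` + abc-iut-L2-t7's
`CuspLaws` + `OncePuncturedData`), every cusp `x`: (1) `D_x ⊆ Π^tp_Y`; (2) `aug(D_x) = G_K`; (3) `I_x ⊆ Ker(↠ell)`;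
(4) `toTheta(I_x) = Δ_Θ`; (5) `D_x` does not centralise `I_x`; (6) `D_x` is non-abelian; (7) `I_x ≃ₜ* Ẑ` equivariantly for
`χ ∘ aug` («`I_x ≅ Ẑ(1)`»); (8) `Δ^tp_{Y_N}` = the `N`-th-power locus, every `N`. [cite: MochizukiEtTh2009, Def 2.1 p.35] -/
theorem jointOrigin_cusp_profile (hO : D.IsEtThOrigin)
    (hYcl : (D.DtpY.map D.toHat.toMonoidHom).topologicalClosure ≤
      D.DtpY.map D.toHat.toMonoidHom ⊔ (⁅⁅D.DeltaHat, D.DeltaHat⁆, D.DeltaHat⁆).topologicalClosure)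
    (h16 : D.IsThm16Origin) (hT : D.IsTateOrigin) (hL : D.CuspLaws) (P : D.OncePuncturedData) {x : D.Pt}
    (hx : D.IsCusp x) :
    D.decomp x ≤ D.GtpY ∧ (D.decomp x).map D.aug.toMonoidHom = D.GK ∧ D.inertia x ≤ (toEll D).ker ∧
      (D.inertia x).map D.toTheta = D.DeltaTheta ∧
      (¬ ∀ d ∈ D.decomp x, ∀ w ∈ D.inertia x, d * w * d⁻¹ = w) ∧
      (¬ ∀ a ∈ D.decomp x, ∀ b ∈ D.decomp x, a * b = b * a) ∧
      (∃ e : ↥(D.inertia x) ≃ₜ* ZHat, ∀ (d : D.PiTemp) (hd : d ∈ D.decomp x) (w : ↥(D.inertia x)),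
        e ⟨d * w * d⁻¹, conj_mem_inf_deltaTemp hd w.2⟩ = SettingModel.chi p (D.aug d) (e w)) ∧
      ∀ N : ℕ+, D.DtpYN N = D.DtpY ⊓ (ellPowersY D N).comap (toEll D) := by
  have hP3 : D.decomp x ≤ D.GtpY := P.decomp_le_ker_toZ x hx
  have hDc : D.IsCuspidalDecompositionGroup (D.decomp x) := ⟨x, hx, 1, (one_smul _ _).symm⟩
  exact ⟨hP3, h16.map_aug_decomp_eq_GK hx hP3, D.inertia_le_ker_toEll_of_origins h16 hT hDc hP3,
    hL.map_toTheta_inertia x hx, D.not_centralises_inertia_of_origins hO hYcl h16 hT hL hx hP3,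
    D.decomp_not_commutative_of_origins hO hYcl h16 hT hL hx hP3,
    D.exists_cyclotomic_inertia_equiv_of_origins hO hYcl h16 hT hL hx hP3,
    fun N => D.dtpYN_eq_of_origins h16 hT N⟩

end ThetaSetting

end Literature.AnabelianGeometry.EtaleTheta

end
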